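import Literature.MathematicalPhysics.QuantumLattice.HubbardWave0LiebProofs
import Literature.LinearAlgebra.Matrix.PosSemidefTrace
import HarnessLib

/-!
# The variational principle for mixed states: `E₀(N) · Tr ρ ≤ Re Tr(ρ H)`

Family `hubbard` (trunk T-QLATTICE). The tree's sector ground energy
`groundEnergy H N = inf {Re⟨ψ, Hψ⟩ : ψ unit, N-particle}` (`HubbardWave0`) satisfies the vector
variational principle `E₀(N)‖ψ‖² ≤ Re⟨ψ, Hψ⟩` (`LiebThm1.groundEnergy_mul_norm_le`). This file proves
the DENSITY-MATRIX form used by variational upper bounds built from mixed trial states (reduced states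
of matrix-product / finitely-correlated states, transfer-operator constructions, Gibbs-like mixtures):

* `groundEnergy_mul_re_trace_le_re_trace_mul` — for every positive semidefinite `ρ` on Fock space
  supported in the `N`-particle sector (`ρ s t = 0` unless `|t| = N`; by hermiticity also unless
  `|s| = N`) and every operator `H`, `groundEnergy H N · Re Tr ρ ≤ Re Tr(ρ H)`;
* `groundEnergy_le_re_trace_mul` — the normalised form `Tr ρ = 1 ⇒ groundEnergy H N ≤ Re Tr(ρ H)`.

Proof (no spectral theorem needed): write `ρ = Cᴴ C` (`CStarAlgebra.nonneg_iff_eq_star_mul_self`),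
replace `C` by `D = C P_N` with `P_N` the diagonal 0/1 projector onto the sector (so `Dᴴ D = P_N ρ P_N = ρ`
by the support hypothesis); then `Tr(ρ H) = Tr(D H Dᴴ) = Σ_s ⟨v_s, H v_s⟩` with `v_s = (Dᴴ)_{·,s}` an
`N`-particle vector, `Tr ρ = Σ_s ‖v_s‖²`, and the vector principle is summed over `s`. The projector
special case (`ρ = P₀` a spectral projector of a quasi-free Hamiltonian) is the tree's
`groundEnergy_le_re_groundStateFunctional` (HartreeFockUpperBound). No named fact is introduced.

## References
* H. Tasaki, *Physics and Mathematics of Quantum Many-Body Systems* (2020), §2.1 (variational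
  characterisation of the ground-state energy; mixed states, (2.1.6) and A.2). [cite: Tasaki2020, §2.1]
* V. Bach, E. H. Lieb, J. P. Solovej, J. Stat. Phys. 76 (1994) 3, eq. (2c.36) (`E^Q ≤ ℰ(γ)`: the
  ground-state energy is below the energy of any (quasi-free) density matrix). [cite: BachLiebSolovej1994, eq. (2c.36)]
-/

noncomputable section

open Matrix Finset
open scoped ComplexOrder MatrixOrder

namespace Literature.MathematicalPhysics.QuantumLattice

variable {ι : Type*} [Fintype ι] [DecidableEq ι]

/-- **Variational principle for mixed states.** For an operator `H` on fermionic Fock space, a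
particle number `N`, and a positive semidefinite `ρ` supported in the `N`-particle sector
(`ρ s t = 0` whenever `|t| ≠ N`), `E₀(N) · Re Tr ρ ≤ Re Tr(ρ H)`, where `E₀(N) = groundEnergy H N`
is the infimum of `Re⟨ψ, Hψ⟩` over unit `N`-particle vectors. Tasaki (2020) §2.1; BLS94 (2c.36).
[cite: Tasaki2020, §2.1] -/
theorem groundEnergy_mul_re_trace_le_re_trace_mul (H : Matrix (Finset ι) (Finset ι) ℂ) {N : ℕ}
    {ρ : Matrix (Finset ι) (Finset ι) ℂ} (hρ : ρ.PosSemidef)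
    (hsupp : ∀ s t : Finset ι, t.card ≠ N → ρ s t = 0) :
    groundEnergy H N * ρ.trace.re ≤ (ρ * H).trace.re := by
  obtain ⟨C, hC⟩ := CStarAlgebra.nonneg_iff_eq_star_mul_self.mp hρ.nonneg
  -- support on the row index as well (hermiticity)
  have hsupp' : ∀ s t : Finset ι, s.card ≠ N → ρ s t = 0 := fun s t hs => by
    rw [← hρ.1.apply s t, hsupp t s hs, star_zero]
  -- the sector-projected factor `D = C P_N`
  set p : Finset ι → ℂ := fun s => if s.card = N then 1 else 0 with hp
  set D : Matrix (Finset ι) (Finset ι) ℂ := fun s k => C s k * p k with hD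
  have hDzero : ∀ s k : Finset ι, k.card ≠ N → D s k = 0 := fun s k hk => by
    simp [hD, hp, hk]
  have hDD : Dᴴ * D = ρ := by
    ext k l
    by_cases hk : k.card = N
    · by_cases hl : l.card = N
      · have hkl : ρ k l = (star C * C) k l := by rw [hC]
        rw [hkl, Matrix.mul_apply, Matrix.star_eq_conjTranspose, Matrix.mul_apply]
        refine Finset.sum_congr rfl fun s _ => ?_
        simp [hD, hp, hk, hl, Matrix.conjTranspose_apply]
      · rw [hsupp k l hl, Matrix.mul_apply]
        exact Finset.sum_eq_zero fun s _ => by rw [hDzero s l hl, mul_zero]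
    · rw [hsupp' k l hk, Matrix.mul_apply]
      exact Finset.sum_eq_zero fun s _ => by
        rw [Matrix.conjTranspose_apply, hDzero s k hk, star_zero, zero_mul]
  -- the vectors `v_s = (Dᴴ)_{·, s}`
  set v : Finset ι → Fock ι := fun s k => star (D s k) with hv
  have hvN : ∀ s, IsNParticle N (v s) := fun s k hk => by
    simp only [hv, hDzero s k hk, star_zero]
  have hexp : ∀ s, expect H (v s) = (D * (H * Dᴴ)) s s := by
    intro s
    simp only [expect, dotProduct, mulVec, Matrix.mul_apply, Matrix.conjTranspose_apply, hv,
      star_star, Pi.star_apply]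
  have htr : (ρ * H).trace = ∑ s, expect H (v s) := by
    rw [← hDD, Matrix.mul_assoc, trace_mul_comm, Matrix.mul_assoc, Matrix.trace]
    exact Finset.sum_congr rfl fun s _ => (hexp s).symm
  have hnorm : ∑ s, star (v s) ⬝ᵥ v s = ρ.trace := by
    rw [← hDD, trace_mul_comm, Matrix.trace]
    refine Finset.sum_congr rfl fun s _ => ?_
    simp only [Matrix.diag_apply, Matrix.mul_apply, Matrix.conjTranspose_apply, dotProduct, hv,
      Pi.star_apply, star_star]
  -- sum the vector variational principle over `s`
  calc groundEnergy H N * ρ.trace.re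
      = ∑ s, groundEnergy H N * (star (v s) ⬝ᵥ v s).re := by
        rw [← hnorm, Complex.re_sum, Finset.mul_sum]
    _ ≤ ∑ s, (expect H (v s)).re :=
        Finset.sum_le_sum fun s _ => LiebThm1.groundEnergy_mul_norm_le H (hvN s)
    _ = (ρ * H).trace.re := by rw [htr, Complex.re_sum]

/-- **Normalised form**: a density matrix `ρ ⪰ 0`, `Tr ρ = 1`, supported in the `N`-particle sector
has `E₀(N) ≤ Re Tr(ρ H)`. Tasaki (2020) §2.1. [cite: Tasaki2020, §2.1] -/
theorem groundEnergy_le_re_trace_mul (H : Matrix (Finset ι) (Finset ι) ℂ) {N : ℕ}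
    {ρ : Matrix (Finset ι) (Finset ι) ℂ} (hρ : ρ.PosSemidef)
    (hsupp : ∀ s t : Finset ι, t.card ≠ N → ρ s t = 0) (htr : ρ.trace = 1) :
    groundEnergy H N ≤ (ρ * H).trace.re := by
  have h := groundEnergy_mul_re_trace_le_re_trace_mul H hρ hsupp
  rwa [htr, Complex.one_re, mul_one] at h

omit [DecidableEq ι] in
/-- The pure case recovered: for a unit `N`-particle vector `ψ`, the rank-one density matrix
`|ψ⟩⟨ψ|` (`vecMulVec ψ (star ψ)`) gives back `E₀(N) ≤ Re⟨ψ, Hψ⟩`. Tasaki (2020) §2.1, (2.1.6).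
[cite: Tasaki2020, §2.1] -/
theorem groundEnergy_le_re_trace_vecMulVec_mul (H : Matrix (Finset ι) (Finset ι) ℂ) {N : ℕ}
    {ψ : Fock ι} (hψN : IsNParticle N ψ) (hψ1 : star ψ ⬝ᵥ ψ = 1) :
    groundEnergy H N ≤ (vecMulVec ψ (star ψ) * H).trace.re := by
  have h : (vecMulVec ψ (star ψ) * H).trace = expect H ψ := by
    rw [trace_mul_comm, Matrix.trace]
    simp only [expect, dotProduct, mulVec, Matrix.diag_apply, Matrix.mul_apply, vecMulVec_apply,
      Pi.star_apply]
    refine Finset.sum_congr rfl fun k _ => ?_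
    rw [Finset.mul_sum]
    refine Finset.sum_congr rfl fun l _ => ?_
    ring
  rw [h]
  exact LiebThm1.groundEnergy_le_re_expect H hψN hψ1

end Literature.MathematicalPhysics.QuantumLattice

end
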